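import Mathlib

/-!
# Route Nc03AvoidResidualCore, item `ResidualCoreReduction` — breadth-first search on bipartite multigraphs

Helper file for `stmt-PneNP-20227` (residual-core reduction of `NC⁰₃-AVOID` at linear stretch; cell
pnp-ideate). Generic combinatorics, no `LocalMap` here: the classes `MAJ₃` and `MUX` of the
reduction are both certified by BALANCED patterns on a large sub-multigraph plus one `𝔽₂`-escape
("rigidity"), and the sub-multigraphs are built from fundamental cycles of BFS forests. A bipartite
multigraph is presented by an edge type `ι`, a vertex type `W` and endpoint maps `eA, eB : ι → W`
landing on the two sides of a side function `W → Bool` (`Bip`). For an edge set `E : Finset ι` we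
define BFS balls `ball E r k`, reachability, the canonical root of a vertex (the least vertex of its
component), its depth (BFS level below its root), its least parent edge `pe`, ancestors `anc`, and
the BFS forest `forest E` (the parent edges), and prove the standard facts: a vertex of positive
depth has a neighbour one level up; adjacent vertices lie exactly one level apart. [folklore]
-/

set_option linter.dupNamespace false -- `Summit.PneNP.PneNP.…`: summit = sub-problem name (D-0017 single-conjunct layout)

namespace Summit.PneNP.PneNP.Theorems.Nc03Reduction

open Finset

/-- A bipartite multigraph on the vertex type `W` presented by its edges: edge `j` joins the
A-vertex `eA j` to the B-vertex `eB j`; `side` separates the two classes. -/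
structure Bip (ι W : Type*) where
  /-- the A-endpoint of an edge -/
  eA : ι → W
  /-- the B-endpoint of an edge -/
  eB : ι → W
  /-- the side of a vertex (`false` = A, `true` = B) -/
  side : W → Bool
  /-- A-endpoints lie on side A -/
  sideA : ∀ j, side (eA j) = false
  /-- B-endpoints lie on side B -/
  sideB : ∀ j, side (eB j) = true

namespace Bip

variable {ι W : Type*} (G : Bip ι W)

/-- The two endpoints of an edge differ. -/
theorem eA_ne_eB (j : ι) : G.eA j ≠ G.eB j := fun h => by
  have h1 := G.sideA j
  rw [h, G.sideB] at h1
  exact Bool.noConfusion h1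

variable [LinearOrder W]

/-- The endpoint set of an edge. -/
def ends (j : ι) : Finset W := {G.eA j, G.eB j}

/-- Membership in the endpoint set. -/
theorem mem_ends {j : ι} {w : W} : w ∈ G.ends j ↔ w = G.eA j ∨ w = G.eB j := by
  simp [ends]

/-- The A-endpoint is an endpoint. -/
theorem eA_mem_ends (j : ι) : G.eA j ∈ G.ends j := G.mem_ends.2 (Or.inl rfl)
/-- The B-endpoint is an endpoint. -/
theorem eB_mem_ends (j : ι) : G.eB j ∈ G.ends j := G.mem_ends.2 (Or.inr rfl)

/-- A vertex of an edge on side B is its B-endpoint. -/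
theorem eq_eB_of_side {j : ι} {w : W} (hw : w ∈ G.ends j) (hs : G.side w = true) : w = G.eB j := by
  rcases G.mem_ends.1 hw with h | h
  · rw [h, G.sideA] at hs; exact Bool.noConfusion hs
  · exact h

/-- A vertex of an edge on side A is its A-endpoint. -/
theorem eq_eA_of_side {j : ι} {w : W} (hw : w ∈ G.ends j) (hs : G.side w = false) : w = G.eA j := by
  rcases G.mem_ends.1 hw with h | h
  · exact h
  · rw [h, G.sideB] at hs; exact Bool.noConfusion hs

/-- Adjacency along the edge set `E`. -/
def Adj (E : Finset ι) (u w : W) : Prop := u ≠ w ∧ ∃ j ∈ E, u ∈ G.ends j ∧ w ∈ G.ends j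

variable {G} in
/-- Adjacency is symmetric. -/
theorem Adj.symm {E : Finset ι} {u w : W} (h : G.Adj E u w) : G.Adj E w u := by
  obtain ⟨hne, j, hj, hu, hw⟩ := h
  exact ⟨hne.symm, j, hj, hw, hu⟩

variable {G} in
/-- Adjacency is monotone in the edge set. -/
theorem Adj.mono {E E' : Finset ι} (hEE : E ⊆ E') {u w : W} (h : G.Adj E u w) : G.Adj E' u w := by
  obtain ⟨hne, j, hj, hu, hw⟩ := h
  exact ⟨hne, j, hEE hj, hu, hw⟩

/-- Adjacent vertices lie on different sides. -/
theorem side_ne_of_adj {E : Finset ι} {u w : W} (h : G.Adj E u w) : G.side u ≠ G.side w := by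
  obtain ⟨hne, j, -, hu, hw⟩ := h
  rcases G.mem_ends.1 hu with hu | hu <;> rcases G.mem_ends.1 hw with hw | hw
  · exact absurd (hu.trans hw.symm) hne
  · rw [hu, hw, G.sideA, G.sideB]; decide
  · rw [hu, hw, G.sideA, G.sideB]; decide
  · exact absurd (hu.trans hw.symm) hne

/-- The two endpoints of an edge of `E` are adjacent. -/
theorem adj_ends {E : Finset ι} {j : ι} (hj : j ∈ E) : G.Adj E (G.eA j) (G.eB j) :=
  ⟨G.eA_ne_eB j, j, hj, G.eA_mem_ends j, G.eB_mem_ends j⟩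

/-- The other endpoint of an edge. -/
def other (j : ι) (w : W) : W := if w = G.eA j then G.eB j else G.eA j

/-- The other endpoint is an endpoint. -/
theorem other_mem_ends (j : ι) (w : W) : G.other j w ∈ G.ends j := by
  unfold other; split
  · exact G.eB_mem_ends j
  · exact G.eA_mem_ends j

/-- The other endpoint differs from an endpoint. -/
theorem other_ne {j : ι} {w : W} (hw : w ∈ G.ends j) : G.other j w ≠ w := by
  unfold other
  split
  · rename_i h; rw [h]; exact (G.eA_ne_eB j).symm
  · rename_i h
    rcases G.mem_ends.1 hw with h' | h'
    · exact absurd h' h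
    · rw [h']; exact G.eA_ne_eB j

/-- The endpoint set consists of an endpoint and the other endpoint. -/
theorem ends_eq_pair {j : ι} {w : W} (hw : w ∈ G.ends j) : G.ends j = {w, G.other j w} := by
  unfold other
  rcases G.mem_ends.1 hw with h | h
  · subst h; simp [ends]
  · subst h; rw [if_neg (G.eA_ne_eB j).symm]; simp [ends, Finset.pair_comm]

/-- A vertex different from a given endpoint is the other endpoint. -/
theorem eq_other {j : ι} {w u : W} (hw : w ∈ G.ends j) (hu : u ∈ G.ends j) (hne : u ≠ w) :
    u = G.other j w := by
  rw [G.ends_eq_pair hw, Finset.mem_insert, Finset.mem_singleton] at hu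
  rcases hu with h | h
  · exact absurd h hne
  · exact h

/-- The other endpoint along an edge of `E` is adjacent. -/
theorem adj_other {E : Finset ι} {j : ι} {w : W} (hj : j ∈ E) (hw : w ∈ G.ends j) :
    G.Adj E (G.other j w) w :=
  ⟨G.other_ne hw, j, hj, G.other_mem_ends j w, hw⟩

/-! ## BFS balls, reachability -/

variable [Fintype W]

noncomputable section
open Classical

/-- The BFS ball of radius `k` around `r` along `E`. -/
def ball (E : Finset ι) (r : W) (k : ℕ) : Finset W :=
  Nat.rec (motive := fun _ => Finset W) {r}
    (fun _ S => S ∪ Finset.univ.filter fun w => ∃ u ∈ S, G.Adj E u w) k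

/-- The ball of radius `0`. -/
theorem ball_zero (E : Finset ι) (r : W) : G.ball E r 0 = {r} := rfl

/-- The ball of radius `k + 1`. -/
theorem ball_succ (E : Finset ι) (r : W) (k : ℕ) :
    G.ball E r (k + 1) = G.ball E r k ∪ Finset.univ.filter fun w => ∃ u ∈ G.ball E r k, G.Adj E u w :=
  rfl

/-- Membership in the ball of radius `0`. -/
theorem mem_ball_zero {E : Finset ι} {r w : W} : w ∈ G.ball E r 0 ↔ w = r := by
  rw [ball_zero, Finset.mem_singleton]

/-- Membership in the ball of radius `k + 1`. -/
theorem mem_ball_succ {E : Finset ι} {r w : W} {k : ℕ} :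
    w ∈ G.ball E r (k + 1) ↔ w ∈ G.ball E r k ∨ ∃ u ∈ G.ball E r k, G.Adj E u w := by
  rw [ball_succ]; simp

/-- Balls grow. -/
theorem ball_subset_succ (E : Finset ι) (r : W) (k : ℕ) : G.ball E r k ⊆ G.ball E r (k + 1) :=
  fun _ hw => G.mem_ball_succ.2 (Or.inl hw)

/-- Balls are monotone in the radius. -/
theorem ball_mono (E : Finset ι) (r : W) {k k' : ℕ} (h : k ≤ k') : G.ball E r k ⊆ G.ball E r k' := by
  induction h with
  | refl => exact Finset.Subset.refl _
  | step _ ih => exact ih.trans (G.ball_subset_succ _ _ _)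

/-- The centre lies in every ball. -/
theorem self_mem_ball (E : Finset ι) (r : W) (k : ℕ) : r ∈ G.ball E r k :=
  G.ball_mono E r (Nat.zero_le k) (G.mem_ball_zero.2 rfl)

/-- A neighbour of a point of the `k`-ball lies in the `(k+1)`-ball. -/
theorem adj_mem_ball_succ {E : Finset ι} {r u w : W} {k : ℕ} (hu : u ∈ G.ball E r k)
    (h : G.Adj E u w) : w ∈ G.ball E r (k + 1) :=
  G.mem_ball_succ.2 (Or.inr ⟨u, hu, h⟩)

/-- Balls compose. -/
theorem ball_trans {E : Finset ι} {r x w : W} {a b : ℕ} (hx : x ∈ G.ball E r a)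
    (hw : w ∈ G.ball E x b) : w ∈ G.ball E r (a + b) := by
  induction b generalizing w with
  | zero => rw [mem_ball_zero] at hw; subst hw; simpa using hx
  | succ b ih =>
    rcases G.mem_ball_succ.1 hw with hw | ⟨u, hu, huw⟩
    · exact G.ball_subset_succ _ _ _ (ih hw)
    · exact G.adj_mem_ball_succ (ih hu) huw

/-- Balls are symmetric: if `w` is within `k` of `r` then `r` is within `k` of `w`. -/
theorem ball_symm {E : Finset ι} {r w : W} {k : ℕ} (h : w ∈ G.ball E r k) : r ∈ G.ball E w k := by
  induction k generalizing w with
  | zero => rw [mem_ball_zero] at h; subst h; exact G.mem_ball_zero.2 rfl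
  | succ k ih =>
    rcases G.mem_ball_succ.1 h with h | ⟨u, hu, huw⟩
    · exact G.ball_subset_succ _ _ _ (ih h)
    · have h1 : u ∈ G.ball E w 1 := G.adj_mem_ball_succ (G.self_mem_ball E w 0) huw.symm
      have h2 := G.ball_trans h1 (ih hu)
      rwa [Nat.add_comm] at h2

/-- Once two consecutive balls agree, the balls are constant from there on. -/
theorem ball_stable_of_eq {E : Finset ι} {r : W} {k : ℕ} (h : G.ball E r k = G.ball E r (k + 1)) :
    ∀ i, G.ball E r (k + i) = G.ball E r k := by
  intro i
  induction i with
  | zero => rfl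
  | succ i ih =>
    have h1 : G.ball E r (k + i + 1) = G.ball E r (k + 1) := by rw [ball_succ, ball_succ, ih]
    rw [← Nat.add_assoc, h1, ← h]

/-- Some two consecutive balls of radius `≤ |W|` agree. -/
theorem exists_stable (E : Finset ι) (r : W) :
    ∃ k ≤ Fintype.card W, G.ball E r k = G.ball E r (k + 1) := by
  by_contra hno
  push Not at hno
  have hgrow : ∀ k ≤ Fintype.card W + 1, k + 1 ≤ (G.ball E r k).card := by
    intro k hk
    induction k with
    | zero => simp [ball_zero]
    | succ k ih =>
      have hss : G.ball E r k ⊂ G.ball E r (k + 1) :=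
        Finset.ssubset_iff_subset_ne.2 ⟨G.ball_subset_succ _ _ _, hno k (by omega)⟩
      have h1 := Finset.card_lt_card hss
      have h2 := ih (by omega)
      omega
  have h1 := hgrow (Fintype.card W + 1) le_rfl
  have h2 : (G.ball E r (Fintype.card W + 1)).card ≤ Fintype.card W := Finset.card_le_univ _
  omega

/-- The ball of radius `|W|` is the whole component: larger radii add nothing. -/
theorem ball_card_add (E : Finset ι) (r : W) (i : ℕ) :
    G.ball E r (Fintype.card W + i) = G.ball E r (Fintype.card W) := by
  obtain ⟨k, hk, hst⟩ := G.exists_stable E r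
  have h1 := G.ball_stable_of_eq hst (Fintype.card W - k + i)
  have h2 := G.ball_stable_of_eq hst (Fintype.card W - k)
  rw [show k + (Fintype.card W - k + i) = Fintype.card W + i by omega] at h1
  rw [show k + (Fintype.card W - k) = Fintype.card W by omega] at h2
  rw [h1, h2]

/-- Reachability along `E`: membership in the ball of radius `|W|`. -/
def Reach (E : Finset ι) (r w : W) : Prop := w ∈ G.ball E r (Fintype.card W)

/-- A vertex in some ball is reachable. -/
theorem reach_of_mem_ball {E : Finset ι} {r w : W} {k : ℕ} (h : w ∈ G.ball E r k) : G.Reach E r w := by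
  unfold Reach
  rcases le_or_gt k (Fintype.card W) with hk | hk
  · exact G.ball_mono E r hk h
  · have h1 := G.ball_card_add E r (k - Fintype.card W)
    rw [show Fintype.card W + (k - Fintype.card W) = k by omega] at h1
    rw [← h1]; exact h

/-- Reachability is reflexive. -/
theorem reach_refl (E : Finset ι) (r : W) : G.Reach E r r := G.self_mem_ball _ _ _

variable {G} in
/-- Reachability is symmetric. -/
theorem Reach.symm {E : Finset ι} {r w : W} (h : G.Reach E r w) : G.Reach E w r :=
  G.reach_of_mem_ball (G.ball_symm h)

variable {G} in
/-- Reachability is transitive. -/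
theorem Reach.trans {E : Finset ι} {r x w : W} (h1 : G.Reach E r x) (h2 : G.Reach E x w) :
    G.Reach E r w :=
  G.reach_of_mem_ball (G.ball_trans h1 h2)

variable {G} in
/-- Adjacent vertices are mutually reachable. -/
theorem Adj.reach {E : Finset ι} {u w : W} (h : G.Adj E u w) : G.Reach E u w :=
  G.reach_of_mem_ball (G.adj_mem_ball_succ (G.self_mem_ball E u 0) h)

/-! ## Roots, depth, parent edges -/

/-- The vertices from which `w` is reachable (its component). -/
def reachers (E : Finset ι) (w : W) : Finset W := Finset.univ.filter fun r => G.Reach E r w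

/-- A vertex reaches itself. -/
theorem self_mem_reachers (E : Finset ι) (w : W) : w ∈ G.reachers E w :=
  Finset.mem_filter.2 ⟨Finset.mem_univ _, G.reach_refl E w⟩

/-- Reachers are members of `reachers`. -/
theorem mem_reachers_of {E : Finset ι} {r w : W} (h : G.Reach E r w) : r ∈ G.reachers E w :=
  Finset.mem_filter.2 ⟨Finset.mem_univ _, h⟩

/-- The canonical root of a vertex: the least vertex of its component. -/
def root (E : Finset ι) (w : W) : W := (G.reachers E w).min' ⟨w, G.self_mem_reachers E w⟩

/-- The root reaches the vertex. -/
theorem root_reach (E : Finset ι) (w : W) : G.Reach E (G.root E w) w := by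
  have h := Finset.min'_mem (G.reachers E w) ⟨w, G.self_mem_reachers E w⟩
  exact (Finset.mem_filter.1 h).2

/-- The root is the least vertex reaching `w`. -/
theorem root_le {E : Finset ι} {r w : W} (h : G.Reach E r w) : G.root E w ≤ r := by
  unfold root
  exact Finset.min'_le _ _ (G.mem_reachers_of h)

/-- Mutually reachable vertices have the same root. -/
theorem root_eq_of_reach {E : Finset ι} {u w : W} (h : G.Reach E u w) : G.root E u = G.root E w :=
  le_antisymm (G.root_le ((G.root_reach E w).trans h.symm)) (G.root_le ((G.root_reach E u).trans h))

/-- Some ball around the root contains the vertex. -/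
theorem exists_ball_root (E : Finset ι) (w : W) : ∃ k, w ∈ G.ball E (G.root E w) k :=
  ⟨_, G.root_reach E w⟩

/-- The depth of a vertex: its BFS level below its root. -/
def depth (E : Finset ι) (w : W) : ℕ := Nat.find (G.exists_ball_root E w)

/-- The vertex lies in the ball of radius `depth` around its root. -/
theorem depth_spec (E : Finset ι) (w : W) : w ∈ G.ball E (G.root E w) (G.depth E w) :=
  Nat.find_spec (G.exists_ball_root E w)

/-- No smaller ball around the root contains the vertex. -/
theorem depth_le {E : Finset ι} {w : W} {k : ℕ} (h : w ∈ G.ball E (G.root E w) k) :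
    G.depth E w ≤ k :=
  Nat.find_min' _ h

/-- Depth zero means being one's own root. -/
theorem depth_eq_zero_iff {E : Finset ι} {w : W} : G.depth E w = 0 ↔ w = G.root E w := by
  constructor
  · intro h
    have h1 := G.depth_spec E w
    rw [h, mem_ball_zero] at h1
    exact h1
  · intro h
    exact Nat.le_zero.1 (G.depth_le (G.mem_ball_zero.2 h))

/-- A vertex of positive depth has a neighbour one level up. -/
theorem exists_up {E : Finset ι} {w : W} {k : ℕ} (h : G.depth E w = k + 1) :
    ∃ u, G.Adj E u w ∧ G.depth E u = k := by
  have hin := G.depth_spec E w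
  rw [h, mem_ball_succ] at hin
  have hnot : w ∉ G.ball E (G.root E w) k := fun hk => by have := G.depth_le hk; omega
  rcases hin with hin | ⟨u, hu, huw⟩
  · exact absurd hin hnot
  refine ⟨u, huw, ?_⟩
  have hru : G.root E u = G.root E w := G.root_eq_of_reach huw.reach
  have hle : G.depth E u ≤ k := by apply G.depth_le; rw [hru]; exact hu
  by_contra hne
  have hlt : G.depth E u < k := lt_of_le_of_ne hle hne
  apply hnot
  have h1 := G.depth_spec E u
  rw [hru] at h1
  exact G.ball_mono E _ (by omega) (G.adj_mem_ball_succ h1 huw)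

/-- A neighbour is at most one level deeper. -/
theorem depth_le_of_adj {E : Finset ι} {u w : W} (h : G.Adj E u w) :
    G.depth E w ≤ G.depth E u + 1 := by
  apply G.depth_le
  rw [← G.root_eq_of_reach h.reach]
  exact G.adj_mem_ball_succ (G.depth_spec E u) h

/-- Sides alternate with depth: the side of a vertex is the side of its root shifted by the parity
of its depth. -/
theorem side_eq_root_xor (E : Finset ι) :
    ∀ d (w : W), G.depth E w = d → G.side w = xor (G.side (G.root E w)) (Nat.bodd d) := by
  intro d
  induction d using Nat.strong_induction_on with
  | _ d ih =>
    intro w hw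
    rcases d with _ | k
    · have h0 := G.depth_eq_zero_iff.1 hw
      rw [← h0]; simp
    · obtain ⟨u, huw, hdu⟩ := G.exists_up hw
      have hu := ih k (by omega) u hdu
      have hsu := G.side_ne_of_adj huw
      rw [G.root_eq_of_reach huw.reach] at hu
      rw [Nat.bodd_succ]
      revert hsu hu
      cases G.side w <;> cases G.side u <;> cases G.side (G.root E w) <;> cases Nat.bodd k <;> simp

/-- Adjacent vertices lie exactly one level apart. -/
theorem depth_adj {E : Finset ι} {u w : W} (h : G.Adj E u w) :
    G.depth E u + 1 = G.depth E w ∨ G.depth E w + 1 = G.depth E u := by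
  have h1 := G.depth_le_of_adj h
  have h2 := G.depth_le_of_adj h.symm
  have hsu := G.side_eq_root_xor E _ u rfl
  have hsw := G.side_eq_root_xor E _ w rfl
  have hne := G.side_ne_of_adj h
  rw [G.root_eq_of_reach h.reach] at hsu
  have hneq : G.depth E u ≠ G.depth E w := by
    intro heq
    apply hne
    rw [hsu, hsw, heq]
  omega

end

end Bip

end Summit.PneNP.PneNP.Theorems.Nc03Reduction
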